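import Summits.NavierStokesRegularity.NavierStokesRegularity.Theorems.QuarterLogPincerSilencingCostKernel
import Summits.NavierStokesRegularity.NavierStokesRegularity.Theorems.QuarterLogPincerSmoothSilenceKernel
import Literature.Analysis.FluidPDE.LocalBiotSavartHelmholtz
import Literature.Analysis.FluidPDE.BiotSavartBounds
import Literature.Analysis.FluidPDE.TaoEnstrophyLocalisation

/-!
# LINE g13-2 «vortical_centre» — Sb `VorticalCentre` by kernel from two LINEAR local-Helmholtz
# centre estimates (ns-idea-7 g13, lens «nearmiss»; crux ⟨stmt-NavierStokesRegularity-24077⟩)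

Target BY NAME: `…Cruxes.TypeIQuantSubcubicExp.SilencingCost.VorticalCentre` (tree
`Theorems/QuarterLogPincerSilencingCostDefs.lean`), the stub Sb shared by the PASSed lines
`silencing_cost` v1.2 (`terminalEmber_of_aftermath_of_vortical_of_thickBox : RegularAftermath →
VorticalCentre → ThickBoxSilencingCost → TerminalEmber`), `smooth_silence` v1.2 (`terminalEmber_of_sharp :
SharpAftermath → VorticalCentre → …`) and `cold_smoothing` v1.1 §5 (`terminalEmberM_of_vortical_of_persistence`).
bears_on: W7 rung R `CubicRung.TypeIQuantCubicExp` through E2/E2♭ (ember programme); no summit is proved.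

WHY THIS LINE (near-miss harvest).  The tree already holds Grujić's localisation of Biot–Savart with ONE
cutoff (`Literature/Analysis/FluidPDE/LocalBiotSavartHelmholtz.lean`:
`smul_eq_biotSavart_add_integral_newtonKernel`, `exists_norm_sub_biotSavart_ballCutoff_le`): for `V ∈ C²`
divergence free on `B(c,6s)`, `‖V(x) − K∗(χ curl V)(x)‖ ≤ 30Λs + C(c,s)·∫_{B̄(c,6s)}(‖curl V‖ + ‖DV‖ + ‖V‖)`.
As a route to Sb it is a NEAR MISS with a MEASURED DEFICIT: (i) the remainder is paid in `∫‖DV‖` over the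
transition shell, which slice energy + the scale-`σ` `C²` bound on `B(y,σ)` do NOT control on `B(y,Γ₂σ)`,
`Γ₂ ≫ 1`; (ii) its constant `C(c,s)` is existential per centre/radius, not scale-covariant.  THE SINGLE
INPUT TO IMPROVE: bound the Newtonian remainder `H = V − K∗(χω)` at the CENTRE by the MEAN-VALUE property
(`H` is harmonic on `B(y,2R/3)` because `G = Δ(χV) + curl(χ curl V)` vanishes where `χ ≡ 1` and `div V = 0`,
tree `laplacian_smul_add_curl_smul_curl_eq`) — energy only, scale-invariant:
`‖H(y)‖ ≤ C(√(E/R³) + √(W/R))` (H2 `HarmonicRemainder`), and bound `K∗(χω)(y)` by the near/far split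
`ρ·sup_{B(y,ρ)}‖ω‖ + |B_R|^{1/2}√W/(4πρ²)` (H1 `HelmholtzNearField`; the crude far field suffices).  Both stubs are LINEAR vector calculus: no hot
centre, no `ε`, no `M₁`-bookkeeping, no Navier–Stokes.  The kernel `vorticalCentre_of_stubs` then does the
`(Γ₂, ρ, δ)` choice of the Sb docstring ONCE: `Γ₂ := 3 + 4C₂√|C₀|/ε`, `ρ := σ·min(1, ε/(4C₁M₁))`,
`δ := (ε·min(1, ε/(4C₁M₁))²/(4(C₁+C₂)))²/Γ₂³` (chosen last), and closes by `ε/σ < ‖v y‖ ≤ 3ε/(4σ)`.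

v1.1 (2026-08-29 09:42Z, 529074e2a832, same slug): H1 `HelmholtzNearField` is PROVED (`helmholtzNearField_holds`, over tree
`BiotSavartBounds` — `norm_biotSavartKernel_le`, `kernelMajorant`, `integral_kernelMajorant` — `norm_curl_le`, Hölder
`ENNReal.lintegral_mul_le_Lp_mul_Lq` on `B(y,R)` and `Measure.addHaar_ball_of_pos`; constant
`C = max(1, ‖curlCLM‖, (4π)⁻¹√|B(0,1)|)`); the line now rests on ONE stub, H2 `HarmonicRemainder` (sorries 1).
v1.3 (≈10:05Z): §4 consumer corollaries BY NAME now that the tree kernels are built (critic N1):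
`terminalEmber_of_aftermath_of_shellKernel_of_thickBox : RegularAftermath → ShellKernelBound → ThickBoxSilencingCost →
EmberCensus.TerminalEmber`, `terminalEmber_of_sharp_of_shellKernel : SharpAftermath → ShellKernelBound →
SharpEnstrophyPersistence → SilencingCost.EmberReadout → EmberCensus.TerminalEmber`.
v1.2 (09:53Z, same slug): H2 is REDUCED (proved, Cauchy–Schwarz on `B(y,R)`) to H2♭ `ShellKernelBound`
`‖v(y) − K∗(χω)(y)‖ ≤ C(R⁻³∫_{B(y,R)}‖v‖ + R⁻²∫_{B(y,R)}‖curl v‖)`, whose proof route is the tree's Green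
representation at the centre + ONE integration by parts on the cutoff shell + explicit `Γ, ∇Γ, ∇χ, Δχ` bounds —
NO mean-value property, no harmonic-function theory (the Mathlib-gap brick of critic note N2 is off the path).
The only `sorry` is `stub_shellKernelBound`; products `vorticalCentre_of_shellKernelBound : ShellKernelBound →
**v1.4 (2026-08-29 ≈10:45Z, same slug): H2♭ `ShellKernelBound` is PROVED (`shellKernelBound_holds`, §1♭) — hence H2
`HarmonicRemainder`, and the target Sb `SilencingCost.VorticalCentre` (`vorticalCentre_via_stubs`), are THEOREMS: the file has
NO `sorry`.  Proof = Green representation at the centre (tree `smul_eq_biotSavart_add_integral_newtonKernel`), density split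
(tree `laplacian_smul_add_curl_smul_curl_eq`), ONE integration by parts per frame index moving `∂ᵢ` off `v`
(tree `integral_newtonKernel_smul_fderiv_eq`), shell bounds `|Γ| ≤ R⁻¹`, `‖DΓ‖ ≤ R⁻²` (`π > 3`), `‖Dχ‖ ≤ 3C₀/R`
(tree `exists_norm_fderiv_ballCutoff_le`) and the NEW scale-covariant brick `‖D²(ballCutoff c r)‖ ≤ C₂/r²`
(`exists_norm_iteratedFDeriv_two_ballCutoff_le`, by `ballCutoff_eq_scale` + `ContinuousLinearMap.iteratedFDeriv_comp_right`).
Consequences BY NAME (all sorry-free here): Sb; `TerminalEmber ⟸ RegularAftermath ∧ ThickBoxSilencingCost` (§4) and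
`TerminalEmber ⟸ SharpAftermath ∧ SharpEnstrophyPersistence ∧ EmberReadout` (§4).  No summit is proved by this line.**
SilencingCost.VorticalCentre`, `harmonicRemainder_of_shellKernelBound`.  BC7: H2♭ CLEAN vs summit and vs Sb
(folder `bc/vc_probe_h2flat*.lean`).

WHY NOVEL vs the listed lines: no line on ⟨24077⟩ touches Sb; silencing_cost / smooth_silence / cold_smoothing
all consume it BY NAME.  After this line the E-chain's open content is: CS1–CS3, H2♭ (plumbing, S–M), Sc′/Sc♮
(+ L♯2, Sa♯) = THE load-bearing silencing cost, and G2.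

CHEAPEST FALSIFIER: none as mathematics (explicit potential theory: Majda–Bertozzi §2.4.1 Prop. 2.16, Lemma 4.5;
Gilbarg–Trudinger Thm 2.1 (mean value), (2.17)); the risk is porting cost (mean-value property for harmonic
functions on balls of `ℝ³` is not in Mathlib; route: Green representation of `H` on the shell + sub-mean-value
of `‖H‖²`, or Poisson kernel).  INSTRUMENT ROW that would refute the key lemma H2: a `C²` divergence-free field
on `ℝ³` with `∫_{B(0,1)}|v|² ≤ 1`, `∫_{B(0,1)}|curl v|² ≤ 1` and `|v(0) − K∗(χ curl v)(0)|` unbounded — impossible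
(harmonic mean value), so the row is a unit test for the port, not a live risk.

C0 (self-critic): Reduction 5 (H1, H2 strictly weaker than Sb: linear, no hot centre; Sb strictly weaker than the
crux) · Attack 5 (kernel PROVED below) · Lever 2–3 (mean value instead of shell-`L¹(DV)`: a small, real delta on
a tree lemma) · Barriers 5 (none of NearOneDssTypeIExclusion / ESS-class barriers quantify over linear
potential theory) · Killable 5 (ports).  BC7: H1 (v1 and restated), H2, Sb probed CLEAN (folder `bc/vc_probe.lean`, `bc/vc_probe_h1v2.lean`);
H1 is now a theorem.
-/

set_option linter.dupNamespace false

noncomputable section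

open MeasureTheory Set Function Filter Topology Metric
open scoped ENNReal NNReal
open Literature.Analysis Literature.Analysis.FluidPDE

namespace Summit.NavierStokesRegularity.NavierStokesRegularity.Cruxes.TypeIQuantSubcubicExp.HelmholtzCentre

open Summit.NavierStokesRegularity.NavierStokesRegularity.Cruxes.TypeIQuantSubcubicExp.SilencingCost
  (VorticalCentre RegularAftermath)
open Summit.NavierStokesRegularity.NavierStokesRegularity.Cruxes.TypeIQuantSubcubicExp.EmberCensus (TerminalEmber)
open Summit.NavierStokesRegularity.NavierStokesRegularity.Cruxes.TypeIQuantSubcubicExp.LimitSilence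
  (ThickBoxSilencingCost)
open Summit.NavierStokesRegularity.NavierStokesRegularity.Cruxes.TypeIQuantSubcubicExp.SmoothSilence
  (SharpAftermath SharpEnstrophyPersistence)

/-! ### §0 The localised vorticity -/

/-- The vorticity of `v` cut off to the ball `B(y,R)`: `χ·curl v` with `χ = ballCutoff y (R/3)` (tree
`BallCutoff.lean`: `χ = 1` on `B̄(y, 2R/3)`, `χ = 0` off `B(y, R)`, `0 ≤ χ ≤ 1`, `χ ∈ C^∞`). -/
def cutVorticity (v : (EuclideanSpace ℝ (Fin 3)) → (EuclideanSpace ℝ (Fin 3))) (y : EuclideanSpace ℝ (Fin 3))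
    (R : ℝ) : (EuclideanSpace ℝ (Fin 3)) → (EuclideanSpace ℝ (Fin 3)) :=
  fun x => ballCutoff y (R / 3) x • curl v x

theorem cutVorticity_apply (v : (EuclideanSpace ℝ (Fin 3)) → (EuclideanSpace ℝ (Fin 3)))
    (y x : EuclideanSpace ℝ (Fin 3)) (R : ℝ) :
    cutVorticity v y R x = ballCutoff y (R / 3) x • curl v x := rfl

/-! ### §1 The statements (LINEAR, scale-invariant, no Navier–Stokes): H1 proved (v1.1); H2 ⟸ H2♭ (v1.2); H2♭ proved (v1.4) -/

/-- **H1 — `HelmholtzNearField` (size S–M; PROVED below in v1.1, `helmholtzNearField_holds`).**  Near/far bound for the Biot–Savart integral of the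
cut-off vorticity AT THE CENTRE: for `v ∈ C²(ℝ³;ℝ³)`, `0 < ρ`, `3ρ ≤ R`, a first-derivative bound
`‖Dv‖ ≤ L` on `B(y,ρ)` and enstrophy `∫_{B(y,R)}‖curl v‖² ≤ W`,
`‖K∗(χ_{y,R} curl v)(y)‖ ≤ C(ρL + √(R³W)/ρ²)`.
Proof sketch: `|K(z)| ≤ (4π|z|²)⁻¹` (tree `norm_biotSavartKernel_le`); near part
`∫_{B(y,ρ)} ‖curl v‖/(4π|x−y|²) ≤ ρ·sup_{B(y,ρ)}‖curl v‖ ≤ ρ‖curlCLM‖L` (`norm_curl_le`, `‖iteratedFDeriv ℝ 1 v x‖ = ‖Dv(x)‖`,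
tree `integral_kernelMajorant`: `∫_{|z|<ρ}|z|⁻² = 4πρ`); far part CRUDELY: `|K| ≤ (4πρ²)⁻¹` off `B(y,ρ)` and
Cauchy–Schwarz on `B(y,R)`, `∫_{B(y,R)}‖χ curl v‖ ≤ |B_R|^{1/2}√W = (4π/3)^{1/2}R^{3/2}√W` (Mathlib
`Measure.addHaar_ball`: `|B_R| = R³|B_1|`) — the sharper `√(W/ρ)` (Cauchy–Schwarz against `|z|⁻⁴`) is not
needed by the kernel, which chooses `δ` last.  Why it might fail: not as mathematics.
Sources: Majda–Bertozzi 2002 §2.4.1 Prop. 2.16, §4.1.3 Lemma 4.5 (tree `norm_biotSavart_le_of_support_subset`,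
`BiotSavartBounds.lean`). -/
def HelmholtzNearField : Prop :=
  ∃ C : ℝ, 1 ≤ C ∧
    ∀ (v : (EuclideanSpace ℝ (Fin 3)) → (EuclideanSpace ℝ (Fin 3))), ContDiff ℝ 2 v →
      ∀ (y : EuclideanSpace ℝ (Fin 3)) (ρ R L W : ℝ), 0 < ρ → 3 * ρ ≤ R →
        (∀ x ∈ ball y ρ, ‖iteratedFDeriv ℝ 1 v x‖ ≤ L) →
        (∫⁻ x in ball y R, ‖curl v x‖ₑ ^ 2 ≤ ENNReal.ofReal W) → 0 ≤ W →
        ‖biotSavart (cutVorticity v y R) y‖ ≤ C * (ρ * L + Real.sqrt (R ^ 3 * W) / ρ ^ 2)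

/-- **H2 — `HarmonicRemainder` (size M; port — THE NEAR-MISS REPAIR).**  For `v ∈ C²(ℝ³;ℝ³)` divergence
free, the Helmholtz remainder `H := v − K∗(χ_{y,R} curl v)` is harmonic on `B(y, 2R/3)` (tree
`smul_eq_biotSavart_add_integral_newtonKernel` + `laplacian_smul_add_curl_smul_curl_eq`: the Newtonian density
`G = Δ(χv) + curl(χ curl v)` vanishes where `χ ≡ 1`), hence by the MEAN-VALUE property and Young's inequality
for `K·1_{B(0,4R/3)} ∈ L¹` (`‖K∗(χω)‖_{L²(B(y,R/3))} ≤ (4R/3)‖χω‖_{L²}`):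
`‖v(y) − K∗(χ_{y,R} curl v)(y)‖ ≤ C(√(E/R³) + √(W/R))` from slice energy `∫_{B(y,R)}|v|² ≤ E` and
enstrophy `∫_{B(y,R)}‖curl v‖² ≤ W` ONLY — no `∫‖Dv‖` on the shell (the deficit of the tree's
`exists_norm_sub_biotSavart_ballCutoff_le`), constants scale-free.  Why it might fail: not as mathematics;
porting cost = mean-value inequality for harmonic functions on balls of `ℝ³` (absent from Mathlib).
Sources: Gilbarg–Trudinger Thm 2.1 + (2.17); Grujić 2009 §3 (3)–(4) (tree `LocalBiotSavartHelmholtz.lean`). -/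
def HarmonicRemainder : Prop :=
  ∃ C : ℝ, 1 ≤ C ∧
    ∀ (v : (EuclideanSpace ℝ (Fin 3)) → (EuclideanSpace ℝ (Fin 3))), ContDiff ℝ 2 v →
      VectorCalculus.IsDivFree v →
      ∀ (y : EuclideanSpace ℝ (Fin 3)) (R E W : ℝ), 0 < R →
        (∫⁻ x in ball y R, ENNReal.ofReal (‖v x‖ ^ 2) ≤ ENNReal.ofReal E) → 0 ≤ E →
        (∫⁻ x in ball y R, ‖curl v x‖ₑ ^ 2 ≤ ENNReal.ofReal W) → 0 ≤ W →
        ‖v y - biotSavart (cutVorticity v y R) y‖ ≤ C * (Real.sqrt (E / R ^ 3) + Real.sqrt (W / R))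

/-- **H2♭ — `ShellKernelBound` (size S–M; v1.2 — the brick-free route to H2).**  For `v ∈ C²(ℝ³;ℝ³)`
divergence free and `R > 0`, AT THE CENTRE of the cutoff `χ = ballCutoff y (R/3)` (`χ ≡ 1` on `B̄(y,2R/3)`):
`‖v(y) − K∗(χ curl v)(y)‖ ≤ C(R⁻³∫_{B(y,R)}‖v‖ + R⁻²∫_{B(y,R)}‖curl v‖)`.
Proof route (no mean-value property, no harmonic-function theory): the tree's Green representation
`smul_eq_biotSavart_add_integral_newtonKernel` gives `v(y) − K∗(χω)(y) = ∫Γ(y−z)G(z)dz` with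
`G = (Δχ)v + 2Σᵢ∂ᵢχ∂ᵢv + ∇χ×ω` (`laplacian_smul_add_curl_smul_curl_eq`, `div v = 0`), supported in the shell
`2R/3 ≤ |z−y| ≤ R` where `Γ(y−·)` is smooth; ONE integration by parts moves `∂ᵢ` off `v` in the middle term:
`∫Γ∂ᵢχ∂ᵢv = ∫[(∂ᵢΓ)(y−z)∂ᵢχ − ΓΔχ]v`; then `|Γ| ≤ 3/(8πR)`, `|∇Γ| ≤ 9/(16πR²)` on the shell and
`|∇χ| ≤ c/R`, `|Δχ| ≤ c/R²` (tree `BallCutoff`/`radialCutoff` derivative bounds) give the integrand bound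
`C(R⁻³‖v‖ + R⁻²‖curl v‖)·1_{B(y,R)}`.  This REMOVES the `∫‖Dv‖`-deficit of `exists_norm_sub_biotSavart_ballCutoff_le`
by IBP instead of by the mean-value inequality (critic N2's Mathlib-gap brick is thereby OFF the E-chain's path).
Why it might fail: not as mathematics; porting cost = IBP of a `C¹` compactly supported product on `ℝ³`
(Mathlib `integral_mul_deriv_eq_deriv_mul`-type lemmas coordinatewise, or the divergence theorem for compactly
supported fields already used in `Literature/Analysis/FluidPDE`).  Sources: Gilbarg–Trudinger §2.4 (2.16)–(2.17);
Grujić 2009 §3 (3)–(4); Majda–Bertozzi §2.4.1. -/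
def ShellKernelBound : Prop :=
  ∃ C : ℝ, 1 ≤ C ∧
    ∀ (v : (EuclideanSpace ℝ (Fin 3)) → (EuclideanSpace ℝ (Fin 3))), ContDiff ℝ 2 v →
      VectorCalculus.IsDivFree v →
      ∀ (y : EuclideanSpace ℝ (Fin 3)) (R : ℝ), 0 < R →
        ‖v y - biotSavart (cutVorticity v y R) y‖ ≤
          C * ((R ^ 3)⁻¹ * (∫ x in ball y R, ‖v x‖) + (R ^ 2)⁻¹ * (∫ x in ball y R, ‖curl v x‖))

/-- **H1 PROVED (v1.1).**  Near/far splitting at the centre: the integrand `‖K(y−x)(χω)(x)‖` is dominated by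
`(4π)⁻¹(κL·1_{|y−x|<ρ}|y−x|⁻² + ρ⁻²‖χω(x)‖)` (`κ = ‖curlCLM‖`; tree `norm_biotSavartKernel_le`, `norm_curl_le`), whose
integral is `κLρ + (4πρ²)⁻¹∫‖χω‖` (tree `integral_kernelMajorant`), and `∫‖χω‖ ≤ ∫_{B(y,R)}‖curl v‖ ≤ |B(y,R)|^{1/2}√W =
√(V₁R³)√W` (Cauchy–Schwarz; `V₁ = |B(0,1)|`, `Measure.addHaar_ball_of_pos`).  Constant `C = max(1, κ, (4π)⁻¹√V₁)`. -/
theorem helmholtzNearField_holds : HelmholtzNearField := by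
  classical
  set V₁ : ℝ := (volume (ball (0 : EuclideanSpace ℝ (Fin 3)) 1)).toReal with hV₁
  have hV₁0 : 0 ≤ V₁ := ENNReal.toReal_nonneg
  set κ : ℝ := ‖curlCLM‖ with hκ
  have hκ0 : 0 ≤ κ := by rw [hκ]; exact norm_nonneg curlCLM
  set C : ℝ := max 1 (max κ ((4 * Real.pi)⁻¹ * Real.sqrt V₁)) with hC
  have hC1 : 1 ≤ C := le_max_left _ _
  have hCκ : κ ≤ C := (le_max_left _ _).trans (le_max_right _ _)
  have hCV : (4 * Real.pi)⁻¹ * Real.sqrt V₁ ≤ C := (le_max_right _ _).trans (le_max_right _ _)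
  have hC0 : 0 ≤ C := by linarith
  refine ⟨C, hC1, ?_⟩
  intro v hv y ρ R L W hρ hρR hL hW hW0
  have hR : 0 < R := by linarith
  set ω' : (EuclideanSpace ℝ (Fin 3)) → (EuclideanSpace ℝ (Fin 3)) := cutVorticity v y R with hω'
  -- (1) pointwise facts about the cut-off vorticity
  have hω'le : ∀ x, ‖ω' x‖ ≤ ‖curl v x‖ := by
    intro x
    rw [hω', cutVorticity_apply, norm_smul, Real.norm_eq_abs, abs_of_nonneg (ballCutoff_nonneg _ _ _)]
    exact mul_le_of_le_one_left (norm_nonneg _) (ballCutoff_le_one _ _ _)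
  have hω'zero : ∀ x, R ≤ ‖x - y‖ → ω' x = 0 := by
    intro x hx
    rw [hω', cutVorticity_apply, ballCutoff_eq_zero (by positivity : 0 < R / 3) (by linarith), zero_smul]
  have hsupp : support ω' ⊆ ball y R := by
    intro x hx
    rw [mem_ball, dist_eq_norm]
    by_contra h
    exact hx (hω'zero x (not_lt.mp h))
  have hcurl_cont : Continuous (curl v) := by
    rw [curl_eq_curlCLM_comp]
    exact curlCLM.continuous.comp (hv.continuous_fderiv (by norm_num))
  have hω'cont : Continuous ω' := by
    have : ω' = fun x => ballCutoff y (R / 3) x • curl v x := rfl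
    rw [this]
    exact (contDiff_ballCutoff y (R / 3) (n := 0)).continuous.smul hcurl_cont
  have hω'cs : HasCompactSupport ω' := by
    refine HasCompactSupport.intro (isCompact_closedBall y R) fun x hx => hω'zero x ?_
    rw [mem_closedBall, dist_eq_norm, not_le] at hx
    exact hx.le
  have hω'int : Integrable ω' := hω'cont.integrable_of_hasCompactSupport hω'cs
  -- (2) the near bound for `curl v` on `B(y,ρ)`
  have hLnonneg : 0 ≤ L := (norm_nonneg _).trans (hL y (mem_ball_self hρ))
  have hcurl_near : ∀ x ∈ ball y ρ, ‖curl v x‖ ≤ κ * L := by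
    intro x hx
    have e : ‖fderiv ℝ v x‖ = ‖iteratedFDeriv ℝ 1 v x‖ := by
      rw [← norm_iteratedFDeriv_zero (𝕜 := ℝ) (f := fderiv ℝ v) (x := x), norm_iteratedFDeriv_fderiv]
    calc ‖curl v x‖ ≤ ‖curlCLM‖ * ‖fderiv ℝ v x‖ := norm_curl_le v x
      _ = κ * ‖iteratedFDeriv ℝ 1 v x‖ := by rw [hκ, e]
      _ ≤ κ * L := by gcongr; exact hL x hx
  -- (3) the integrable majorant of the Biot–Savart integrand
  set g : (EuclideanSpace ℝ (Fin 3)) → ℝ :=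
    fun x => (4 * Real.pi)⁻¹ * ((κ * L) * kernelMajorant ρ (y - x) + (ρ ^ 2)⁻¹ * ‖ω' x‖) with hg
  have hkm_int : Integrable (fun x => kernelMajorant ρ (y - x)) := (integrable_kernelMajorant ρ).comp_sub_left y
  have hgint : Integrable g :=
    ((hkm_int.const_mul _).add (hω'int.norm.const_mul _)).const_mul _
  have hpt : ∀ x, ‖biotSavartKernel (y - x) (ω' x)‖ ≤ g x := by
    intro x
    have hK := norm_biotSavartKernel_le (y - x) (ω' x)
    by_cases hx : ‖y - x‖ < ρ
    · have hxball : x ∈ ball y ρ := by rwa [mem_ball, dist_eq_norm, norm_sub_rev]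
      have hmaj : kernelMajorant ρ (y - x) = (‖y - x‖ ^ 2)⁻¹ := by
        rw [kernelMajorant, indicator_of_mem (mem_ball_zero_iff.mpr hx)]
      have hωx : ‖ω' x‖ ≤ κ * L := (hω'le x).trans (hcurl_near x hxball)
      calc ‖biotSavartKernel (y - x) (ω' x)‖ ≤ (4 * Real.pi)⁻¹ * ‖ω' x‖ * (‖y - x‖ ^ 2)⁻¹ := hK
        _ ≤ (4 * Real.pi)⁻¹ * (κ * L) * (‖y - x‖ ^ 2)⁻¹ := by gcongr
        _ = (4 * Real.pi)⁻¹ * ((κ * L) * kernelMajorant ρ (y - x)) := by rw [hmaj]; ring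
        _ ≤ g x := by
            have h0 : 0 ≤ (4 * Real.pi)⁻¹ * ((ρ ^ 2)⁻¹ * ‖ω' x‖) := by positivity
            simp only [hg, mul_add]
            linarith
    · have hx' : ρ ≤ ‖y - x‖ := not_lt.mp hx
      have hinv : (‖y - x‖ ^ 2)⁻¹ ≤ (ρ ^ 2)⁻¹ :=
        inv_anti₀ (by positivity) (pow_le_pow_left₀ hρ.le hx' 2)
      calc ‖biotSavartKernel (y - x) (ω' x)‖ ≤ (4 * Real.pi)⁻¹ * ‖ω' x‖ * (‖y - x‖ ^ 2)⁻¹ := hK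
        _ ≤ (4 * Real.pi)⁻¹ * ‖ω' x‖ * (ρ ^ 2)⁻¹ := by gcongr
        _ = (4 * Real.pi)⁻¹ * ((ρ ^ 2)⁻¹ * ‖ω' x‖) := by ring
        _ ≤ g x := by
            have h0 : 0 ≤ (4 * Real.pi)⁻¹ * ((κ * L) * kernelMajorant ρ (y - x)) := by
              have := kernelMajorant_nonneg ρ (y - x)
              positivity
            simp only [hg, mul_add]
            linarith
  -- (4) integrate the majorant
  have hI : ‖biotSavart ω' y‖ ≤ ∫ x, g x := by
    rw [biotSavart]
    exact (norm_integral_le_integral_norm _).trans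
      (integral_mono_of_nonneg (Eventually.of_forall fun x => norm_nonneg _) hgint (Eventually.of_forall hpt))
  have hIg : ∫ x, g x = (κ * L) * ρ + (4 * Real.pi)⁻¹ * (ρ ^ 2)⁻¹ * ∫ x, ‖ω' x‖ := by
    simp only [hg]
    rw [integral_const_mul, integral_add (hkm_int.const_mul _) (hω'int.norm.const_mul _), integral_const_mul,
      integral_const_mul, integral_sub_left_eq_self (kernelMajorant ρ) volume y, integral_kernelMajorant hρ.le]
    field_simp
  -- (5) the far mass by Cauchy–Schwarz on `B(y,R)`
  have hfar : ∫ x, ‖ω' x‖ ≤ Real.sqrt (V₁ * R ^ 3) * Real.sqrt W := by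
    have h1 : ∫ x, ‖ω' x‖ = (∫⁻ x, ‖ω' x‖ₑ).toReal := by
      rw [integral_eq_lintegral_of_nonneg_ae (Eventually.of_forall fun x => norm_nonneg _)
        hω'int.norm.aestronglyMeasurable]
      simp_rw [ofReal_norm]
    have h2 : ∫⁻ x, ‖ω' x‖ₑ = ∫⁻ x in ball y R, ‖ω' x‖ₑ := by
      refine (setLIntegral_eq_of_support_subset ?_).symm
      intro x hx
      exact hsupp (by simpa using hx)
    have h3 : ∫⁻ x in ball y R, ‖ω' x‖ₑ ≤ ∫⁻ x in ball y R, ‖curl v x‖ₑ := by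
      refine lintegral_mono fun x => ?_
      rw [← ofReal_norm, ← ofReal_norm]
      exact ENNReal.ofReal_le_ofReal (hω'le x)
    have hpq : Real.HolderConjugate 2 2 := ⟨by norm_num, by norm_num, by norm_num⟩
    have h4 := ENNReal.lintegral_mul_le_Lp_mul_Lq (volume.restrict (ball y R)) hpq
      (f := fun _ => (1 : ℝ≥0∞)) (g := fun x => ‖curl v x‖ₑ) aemeasurable_const
      hcurl_cont.enorm.aemeasurable
    have h4' : ∫⁻ x in ball y R, ‖curl v x‖ₑ ≤
        (volume (ball y R)) ^ (1 / 2 : ℝ) * (∫⁻ x in ball y R, ‖curl v x‖ₑ ^ 2) ^ (1 / 2 : ℝ) := by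
      have e1 : ((fun _ => (1 : ℝ≥0∞)) * fun x => ‖curl v x‖ₑ) = fun x => ‖curl v x‖ₑ := by
        funext x; simp
      have e2 : ∫⁻ _ in ball y R, (1 : ℝ≥0∞) ^ (2 : ℝ) = volume (ball y R) := by
        rw [ENNReal.one_rpow, setLIntegral_const, one_mul]
      have e3 : (fun x => ‖curl v x‖ₑ ^ (2 : ℝ)) = fun x => ‖curl v x‖ₑ ^ 2 := by
        funext x; exact ENNReal.rpow_two _
      rw [e1, e2, e3] at h4
      exact h4
    have hvol : volume (ball y R) = ENNReal.ofReal (R ^ 3) * volume (ball (0 : EuclideanSpace ℝ (Fin 3)) 1) := by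
      rw [Measure.addHaar_ball_of_pos _ _ hR, finrank_euclideanSpace, Fintype.card_fin]
    have hvol_top : volume (ball y R) ≠ ⊤ := measure_ball_lt_top.ne
    have hV₁top : volume (ball (0 : EuclideanSpace ℝ (Fin 3)) 1) ≠ ⊤ := measure_ball_lt_top.ne
    -- chain in `ℝ≥0∞`
    have h5 : ∫⁻ x, ‖ω' x‖ₑ ≤
        (volume (ball y R)) ^ (1 / 2 : ℝ) * (ENNReal.ofReal W) ^ (1 / 2 : ℝ) := by
      rw [h2]
      refine (h3.trans h4').trans ?_
      gcongr
    have htop : (volume (ball y R)) ^ (1 / 2 : ℝ) * (ENNReal.ofReal W) ^ (1 / 2 : ℝ) ≠ ⊤ := by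
      refine ENNReal.mul_ne_top ?_ ?_
      · exact ENNReal.rpow_ne_top_of_nonneg (by norm_num) hvol_top
      · exact ENNReal.rpow_ne_top_of_nonneg (by norm_num) ENNReal.ofReal_ne_top
    have h6 := ENNReal.toReal_mono htop h5
    rw [ENNReal.toReal_mul, ← ENNReal.toReal_rpow, ← ENNReal.toReal_rpow, ENNReal.toReal_ofReal hW0, hvol,
      ENNReal.toReal_mul, ENNReal.toReal_ofReal (by positivity)] at h6
    rw [h1, Real.sqrt_eq_rpow, Real.sqrt_eq_rpow, show V₁ * R ^ 3 = R ^ 3 * V₁ by ring]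
    exact h6
  -- (6) assemble
  have hmain : ‖biotSavart ω' y‖ ≤ κ * (ρ * L) + ((4 * Real.pi)⁻¹ * Real.sqrt V₁) * (Real.sqrt (R ^ 3 * W) / ρ ^ 2) := by
    have hρ2 : 0 < ρ ^ 2 := by positivity
    calc ‖biotSavart ω' y‖ ≤ (κ * L) * ρ + (4 * Real.pi)⁻¹ * (ρ ^ 2)⁻¹ * ∫ x, ‖ω' x‖ := by rw [← hIg]; exact hI
      _ ≤ (κ * L) * ρ + (4 * Real.pi)⁻¹ * (ρ ^ 2)⁻¹ * (Real.sqrt (V₁ * R ^ 3) * Real.sqrt W) := by gcongr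
      _ = κ * (ρ * L) + ((4 * Real.pi)⁻¹ * Real.sqrt V₁) * (Real.sqrt (R ^ 3 * W) / ρ ^ 2) := by
          rw [Real.sqrt_mul hV₁0, Real.sqrt_mul (by positivity : (0 : ℝ) ≤ R ^ 3) W]
          field_simp
  have hρL : 0 ≤ ρ * L := by positivity
  have hT : 0 ≤ Real.sqrt (R ^ 3 * W) / ρ ^ 2 := by positivity
  calc ‖biotSavart (cutVorticity v y R) y‖ = ‖biotSavart ω' y‖ := rfl
    _ ≤ κ * (ρ * L) + ((4 * Real.pi)⁻¹ * Real.sqrt V₁) * (Real.sqrt (R ^ 3 * W) / ρ ^ 2) := hmain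
    _ ≤ C * (ρ * L) + C * (Real.sqrt (R ^ 3 * W) / ρ ^ 2) := by gcongr
    _ = C * (ρ * L + Real.sqrt (R ^ 3 * W) / ρ ^ 2) := by ring

/-- H1 (by-name stability of the stub list: now a theorem). -/
theorem stub_helmholtzNearField : HelmholtzNearField := helmholtzNearField_holds

/-- Cauchy–Schwarz on a ball of `ℝ³` (used for H2♭ → H2): `∫_{B(y,R)}‖f‖ ≤ √(|B₁|R³)·√W` when
`∫_{B(y,R)}‖f‖² ≤ W`. -/
theorem setIntegral_norm_le_sqrt_vol_mul_sqrt
    {f : (EuclideanSpace ℝ (Fin 3)) → (EuclideanSpace ℝ (Fin 3))} (hf : Continuous f)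
    {y : EuclideanSpace ℝ (Fin 3)} {R W : ℝ} (hR : 0 < R)
    (hW : ∫⁻ x in ball y R, ‖f x‖ₑ ^ 2 ≤ ENNReal.ofReal W) (hW0 : 0 ≤ W) :
    ∫ x in ball y R, ‖f x‖ ≤
      Real.sqrt ((volume (ball (0 : EuclideanSpace ℝ (Fin 3)) 1)).toReal * R ^ 3) * Real.sqrt W := by
  have h1 : ∫ x in ball y R, ‖f x‖ = (∫⁻ x in ball y R, ‖f x‖ₑ).toReal := by
    rw [integral_eq_lintegral_of_nonneg_ae (Eventually.of_forall fun x => norm_nonneg _)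
      hf.norm.aestronglyMeasurable]
    simp_rw [ofReal_norm]
  have hpq : Real.HolderConjugate 2 2 := ⟨by norm_num, by norm_num, by norm_num⟩
  have h4 := ENNReal.lintegral_mul_le_Lp_mul_Lq (volume.restrict (ball y R)) hpq
    (f := fun _ => (1 : ℝ≥0∞)) (g := fun x => ‖f x‖ₑ) aemeasurable_const hf.enorm.aemeasurable
  have h4' : ∫⁻ x in ball y R, ‖f x‖ₑ ≤
      (volume (ball y R)) ^ (1 / 2 : ℝ) * (∫⁻ x in ball y R, ‖f x‖ₑ ^ 2) ^ (1 / 2 : ℝ) := by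
    have e1 : ((fun _ => (1 : ℝ≥0∞)) * fun x => ‖f x‖ₑ) = fun x => ‖f x‖ₑ := by
      funext x; simp
    have e2 : ∫⁻ _ in ball y R, (1 : ℝ≥0∞) ^ (2 : ℝ) = volume (ball y R) := by
      rw [ENNReal.one_rpow, setLIntegral_const, one_mul]
    have e3 : (fun x => ‖f x‖ₑ ^ (2 : ℝ)) = fun x => ‖f x‖ₑ ^ 2 := by
      funext x; exact ENNReal.rpow_two _
    rw [e1, e2, e3] at h4
    exact h4
  have hvol : volume (ball y R) = ENNReal.ofReal (R ^ 3) * volume (ball (0 : EuclideanSpace ℝ (Fin 3)) 1) := by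
    rw [Measure.addHaar_ball_of_pos _ _ hR, finrank_euclideanSpace, Fintype.card_fin]
  have hvol_top : volume (ball y R) ≠ ⊤ := measure_ball_lt_top.ne
  have h5 : ∫⁻ x in ball y R, ‖f x‖ₑ ≤
      (volume (ball y R)) ^ (1 / 2 : ℝ) * (ENNReal.ofReal W) ^ (1 / 2 : ℝ) := by
    refine h4'.trans ?_
    gcongr
  have htop : (volume (ball y R)) ^ (1 / 2 : ℝ) * (ENNReal.ofReal W) ^ (1 / 2 : ℝ) ≠ ⊤ := by
    refine ENNReal.mul_ne_top ?_ ?_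
    · exact ENNReal.rpow_ne_top_of_nonneg (by norm_num) hvol_top
    · exact ENNReal.rpow_ne_top_of_nonneg (by norm_num) ENNReal.ofReal_ne_top
  have h6 := ENNReal.toReal_mono htop h5
  rw [ENNReal.toReal_mul, ← ENNReal.toReal_rpow, ← ENNReal.toReal_rpow, ENNReal.toReal_ofReal hW0, hvol,
    ENNReal.toReal_mul, ENNReal.toReal_ofReal (by positivity)] at h6
  rw [h1, Real.sqrt_eq_rpow, Real.sqrt_eq_rpow,
    show (volume (ball (0 : EuclideanSpace ℝ (Fin 3)) 1)).toReal * R ^ 3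
      = R ^ 3 * (volume (ball (0 : EuclideanSpace ℝ (Fin 3)) 1)).toReal by ring]
  exact h6

/-- **H2 ⟸ H2♭ (v1.2, PROVED):** Cauchy–Schwarz `R⁻³∫_{B_R}‖v‖ ≤ √|B₁|·√(E/R³)`, `R⁻²∫_{B_R}‖curl v‖ ≤ √|B₁|·√(W/R)`. -/
theorem harmonicRemainder_of_shellKernelBound (h : ShellKernelBound) : HarmonicRemainder := by
  obtain ⟨C, hC1, hC⟩ := h
  have hC0 : 0 ≤ C := by linarith
  set V₁ : ℝ := (volume (ball (0 : EuclideanSpace ℝ (Fin 3)) 1)).toReal with hV₁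
  have hV₁0 : 0 ≤ V₁ := ENNReal.toReal_nonneg
  refine ⟨max 1 (C * Real.sqrt V₁), le_max_left _ _, ?_⟩
  intro v hv hdiv y R E W hR hE hE0 hW hW0
  have hR0 : R ≠ 0 := hR.ne'
  have hcurl_cont : Continuous (curl v) := by
    rw [curl_eq_curlCLM_comp]
    exact curlCLM.continuous.comp (hv.continuous_fderiv (by norm_num))
  have hE' : ∫⁻ x in ball y R, ‖v x‖ₑ ^ 2 ≤ ENNReal.ofReal E := by
    have e : (fun x => ENNReal.ofReal (‖v x‖ ^ 2)) = fun x => ‖v x‖ₑ ^ 2 := by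
      funext x; rw [ENNReal.ofReal_pow (norm_nonneg _), ofReal_norm]
    rw [e] at hE
    exact hE
  have hIv := setIntegral_norm_le_sqrt_vol_mul_sqrt hv.continuous hR hE' hE0
  have hIw := setIntegral_norm_le_sqrt_vol_mul_sqrt hcurl_cont hR hW hW0
  have e1 : (R ^ 3)⁻¹ * (Real.sqrt (V₁ * R ^ 3) * Real.sqrt E) = Real.sqrt V₁ * Real.sqrt (E / R ^ 3) := by
    have hs : Real.sqrt (R ^ 3) * Real.sqrt (R ^ 3) = R ^ 3 := Real.mul_self_sqrt (by positivity)
    have hs0 : 0 < Real.sqrt (R ^ 3) := Real.sqrt_pos.mpr (by positivity)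
    rw [Real.sqrt_mul hV₁0, Real.sqrt_div hE0]
    field_simp
    rw [Real.sq_sqrt (by positivity : (0 : ℝ) ≤ R ^ 3)]
    ring
  have e2 : (R ^ 2)⁻¹ * (Real.sqrt (V₁ * R ^ 3) * Real.sqrt W) = Real.sqrt V₁ * Real.sqrt (W / R) := by
    have hR3 : Real.sqrt (R ^ 3) = R * Real.sqrt R := by
      rw [show R ^ 3 = R ^ 2 * R by ring, Real.sqrt_mul (by positivity), Real.sqrt_sq hR.le]
    have hs : Real.sqrt R * Real.sqrt R = R := Real.mul_self_sqrt hR.le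
    have hs0 : 0 < Real.sqrt R := Real.sqrt_pos.mpr hR
    rw [Real.sqrt_mul hV₁0, hR3, Real.sqrt_div hW0]
    field_simp
    rw [Real.sq_sqrt hR.le]
    ring
  calc ‖v y - biotSavart (cutVorticity v y R) y‖
      ≤ C * ((R ^ 3)⁻¹ * (∫ x in ball y R, ‖v x‖) + (R ^ 2)⁻¹ * (∫ x in ball y R, ‖curl v x‖)) :=
        hC v hv hdiv y R hR
    _ ≤ C * ((R ^ 3)⁻¹ * (Real.sqrt (V₁ * R ^ 3) * Real.sqrt E)
          + (R ^ 2)⁻¹ * (Real.sqrt (V₁ * R ^ 3) * Real.sqrt W)) := by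
        have h3 : (0 : ℝ) ≤ (R ^ 3)⁻¹ := by positivity
        have h2 : (0 : ℝ) ≤ (R ^ 2)⁻¹ := by positivity
        have hIv' : (R ^ 3)⁻¹ * (∫ x in ball y R, ‖v x‖) ≤ (R ^ 3)⁻¹ * (Real.sqrt (V₁ * R ^ 3) * Real.sqrt E) :=
          mul_le_mul_of_nonneg_left hIv h3
        have hIw' : (R ^ 2)⁻¹ * (∫ x in ball y R, ‖curl v x‖) ≤
            (R ^ 2)⁻¹ * (Real.sqrt (V₁ * R ^ 3) * Real.sqrt W) :=
          mul_le_mul_of_nonneg_left hIw h2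
        exact mul_le_mul_of_nonneg_left (add_le_add hIv' hIw') hC0
    _ = (C * Real.sqrt V₁) * (Real.sqrt (E / R ^ 3) + Real.sqrt (W / R)) := by rw [e1, e2]; ring
    _ ≤ max 1 (C * Real.sqrt V₁) * (Real.sqrt (E / R ^ 3) + Real.sqrt (W / R)) := by
        gcongr; exact le_max_right _ _

/-! ### §1♭ H2♭ `ShellKernelBound` PROVED (v1.4) — cutoff calculus, the centre identity, the shell bound -/

section ShellKernel

open InnerProductSpace
open scoped Laplacian

/-! #### (a) scale-covariant second-derivative bound for `ballCutoff` (NEW brick) -/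

theorem exists_norm_iteratedFDeriv_two_ballCutoff_le :
    ∃ C₂ : ℝ, 0 ≤ C₂ ∧ ∀ (c : (EuclideanSpace ℝ (Fin 3))) (r : ℝ), 0 < r → ∀ z : (EuclideanSpace ℝ (Fin 3)),
      ‖iteratedFDeriv ℝ 2 (ballCutoff c r) z‖ ≤ C₂ / r ^ 2 := by
  set θ : (EuclideanSpace ℝ (Fin 3)) → ℝ := radialCutoff 2 3 with hθ
  have hθs : ContDiff ℝ 2 θ := radialCutoff_contDiff 2 3
  have hθc : HasCompactSupport θ := hasCompactSupport_radialCutoff (by norm_num) (by norm_num)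
  obtain ⟨C, hC⟩ := (hθs.continuous_iteratedFDeriv (m := 2) le_rfl).bounded_above_of_compact_support
    (hθc.iteratedFDeriv (𝕜 := ℝ) 2)
  refine ⟨max C 0, le_max_right _ _, fun c r hr z => ?_⟩
  set L : (EuclideanSpace ℝ (Fin 3)) →L[ℝ] (EuclideanSpace ℝ (Fin 3)) := r⁻¹ • ContinuousLinearMap.id ℝ (EuclideanSpace ℝ (Fin 3)) with hL
  have hfun : ballCutoff c r = fun y => (θ ∘ ⇑L) (y - c) := by
    funext y
    rw [ballCutoff_eq_scale hr y]
    simp [hL, hθ]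
  have hnL : ‖L‖ ≤ r⁻¹ := by
    rw [hL, norm_smul, norm_inv, Real.norm_of_nonneg hr.le]
    exact mul_le_of_le_one_right (inv_nonneg.2 hr.le) ContinuousLinearMap.norm_id_le
  rw [hfun, show (fun y => (θ ∘ ⇑L) (y - c)) = fun y => (θ ∘ ⇑L) (y - c) from rfl,
    congrFun (iteratedFDeriv_comp_sub' (𝕜 := ℝ) (f := θ ∘ ⇑L) 2 c) z,
    ContinuousLinearMap.iteratedFDeriv_comp_right L hθs (z - c) (i := 2) le_rfl]
  calc ‖(iteratedFDeriv ℝ 2 θ (L (z - c))).compContinuousLinearMap fun _ => L‖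
      ≤ ‖iteratedFDeriv ℝ 2 θ (L (z - c))‖ * ∏ _i : Fin 2, ‖L‖ :=
        ContinuousMultilinearMap.norm_compContinuousLinearMap_le _ _
    _ ≤ max C 0 * (r⁻¹) ^ 2 := by
        rw [Finset.prod_const, Finset.card_univ, Fintype.card_fin]
        exact mul_le_mul ((hC _).trans (le_max_left _ _)) (pow_le_pow_left₀ (norm_nonneg _) hnL 2)
          (by positivity) (le_max_right _ _)
    _ = max C 0 / r ^ 2 := by rw [div_eq_mul_inv, inv_pow]

/-! #### (b) the cutoff's derivatives vanish on the plateau `B(c,2r)` and off `B̄(c,3r)`; `|Δχ| ≤ 3‖D²χ‖` -/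

theorem fderiv_ballCutoff_eq_zero_of_mem {c : (EuclideanSpace ℝ (Fin 3))} {r : ℝ} (hr : 0 < r) {z : (EuclideanSpace ℝ (Fin 3))} (hz : z ∈ ball c (2 * r)) :
    fderiv ℝ (ballCutoff c r) z = 0 := by
  rw [(ballCutoff_eventuallyEq_one hr hz).fderiv_eq, fderiv_const_apply]

theorem fderiv_ballCutoff_eq_zero_of_notMem {c : (EuclideanSpace ℝ (Fin 3))} {r : ℝ} (hr : 0 < r) {z : (EuclideanSpace ℝ (Fin 3))}
    (hz : z ∉ closedBall c (3 * r)) : fderiv ℝ (ballCutoff c r) z = 0 := by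
  rw [(ballCutoff_eventuallyEq_zero hr hz).fderiv_eq, fderiv_const_apply]

theorem iteratedFDeriv_two_ballCutoff_eq_zero_of_mem {c : (EuclideanSpace ℝ (Fin 3))} {r : ℝ} (hr : 0 < r) {z : (EuclideanSpace ℝ (Fin 3))}
    (hz : z ∈ ball c (2 * r)) : iteratedFDeriv ℝ 2 (ballCutoff c r) z = 0 := by
  rw [((ballCutoff_eventuallyEq_one hr hz).iteratedFDeriv (𝕜 := ℝ) 2).eq_of_nhds, iteratedFDeriv_const_of_ne (by norm_num)]
  rfl

theorem iteratedFDeriv_two_ballCutoff_eq_zero_of_notMem {c : (EuclideanSpace ℝ (Fin 3))} {r : ℝ} (hr : 0 < r) {z : (EuclideanSpace ℝ (Fin 3))}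
    (hz : z ∉ closedBall c (3 * r)) : iteratedFDeriv ℝ 2 (ballCutoff c r) z = 0 := by
  rw [((ballCutoff_eventuallyEq_zero hr hz).iteratedFDeriv (𝕜 := ℝ) 2).eq_of_nhds, iteratedFDeriv_const_of_ne (by norm_num)]
  rfl

/-- `|D²χ(z)(a,b)| ≤ ‖D²χ(z)‖‖a‖‖b‖` specialised to unit vectors of an orthonormal basis. -/
theorem abs_iteratedFDeriv_two_apply_le (χ : (EuclideanSpace ℝ (Fin 3)) → ℝ) (z a b : (EuclideanSpace ℝ (Fin 3))) (ha : ‖a‖ = 1) (hb : ‖b‖ = 1) :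
    |iteratedFDeriv ℝ 2 χ z ![a, b]| ≤ ‖iteratedFDeriv ℝ 2 χ z‖ := by
  rw [← Real.norm_eq_abs]
  refine (ContinuousMultilinearMap.le_opNorm _ _).trans ?_
  rw [Fin.prod_univ_two]
  simp [ha, hb]

/-- `|Δχ(z)| ≤ 3‖D²χ(z)‖`. -/
theorem abs_laplacian_le_three_mul_norm_iteratedFDeriv (χ : (EuclideanSpace ℝ (Fin 3)) → ℝ) (z : (EuclideanSpace ℝ (Fin 3))) :
    |(Δ χ) z| ≤ 3 * ‖iteratedFDeriv ℝ 2 χ z‖ := by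
  set b := stdOrthonormalBasis ℝ (EuclideanSpace ℝ (Fin 3)) with hb
  rw [laplacian_eq_iteratedFDeriv_orthonormalBasis χ b]
  have h1 : ∀ i, |iteratedFDeriv ℝ 2 χ z ![b i, b i]| ≤ ‖iteratedFDeriv ℝ 2 χ z‖ := fun i =>
    abs_iteratedFDeriv_two_apply_le χ z (b i) (b i) (b.orthonormal.1 i) (b.orthonormal.1 i)
  have hcard : (Finset.univ : Finset (Fin (Module.finrank ℝ (EuclideanSpace ℝ (Fin 3))))).card = 3 := by
    rw [Finset.card_univ, Fintype.card_fin, finrank_euclideanSpace, Fintype.card_fin]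
  calc |∑ i, iteratedFDeriv ℝ 2 χ z ![b i, b i]|
      ≤ ∑ i, |iteratedFDeriv ℝ 2 χ z ![b i, b i]| := Finset.abs_sum_le_sum_abs _ _
    _ ≤ ∑ _i : Fin (Module.finrank ℝ (EuclideanSpace ℝ (Fin 3))), ‖iteratedFDeriv ℝ 2 χ z‖ := Finset.sum_le_sum fun i _ => h1 i
    _ = 3 * ‖iteratedFDeriv ℝ 2 χ z‖ := by rw [Finset.sum_const, hcard]; simp


/-! #### (c) the centre identity, integration by parts, and the shell bound -/

set_option maxHeartbeats 4000000 in
/-- **H2♭ `ShellKernelBound` HOLDS (v1.4).**  Green representation at the centre + density split + one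
integration by parts per frame index (tree `integral_newtonKernel_smul_fderiv_eq`) + the shell bounds
`|Γ| ≤ R⁻¹`, `‖DΓ‖ ≤ R⁻²`, `‖Dχ‖ ≤ 3C₀/R`, `‖D²χ‖ ≤ 9C₂/R²`; constant `C = 1 + 81C₂ + 18C₀ + 3‖curlCLM‖C₀`. -/
theorem shellKernelBound_holds : ShellKernelBound := by
  obtain ⟨C₀, hC₀0, hC₀⟩ := exists_norm_fderiv_ballCutoff_le
  obtain ⟨C₂, hC₂0, hC₂⟩ := exists_norm_iteratedFDeriv_two_ballCutoff_le
  have hκ0 : 0 ≤ ‖curlCLM‖ := by positivity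
  refine ⟨1 + 81 * C₂ + 18 * C₀ + 3 * ‖curlCLM‖ * C₀,
    by nlinarith [mul_nonneg hκ0 hC₀0], ?_⟩
  intro v hv hdiv y R hR
  have hR0 : R ≠ 0 := hR.ne'
  have hr : 0 < R / 3 := by positivity
  -- the cutoff `χ = ballCutoff y (R/3)` under an opaque name
  obtain ⟨χ, hχdef⟩ : ∃ χ : (EuclideanSpace ℝ (Fin 3)) → ℝ, χ = ballCutoff y (R / 3) := ⟨_, rfl⟩
  have hχ2 : ContDiff ℝ 2 χ := by rw [hχdef]; exact contDiff_ballCutoff y (R / 3)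
  have hχ1 : ContDiff ℝ 1 χ := by rw [hχdef]; exact contDiff_ballCutoff y (R / 3)
  have hχc : HasCompactSupport χ := by rw [hχdef]; exact hasCompactSupport_ballCutoff hr
  have hχy : χ y = 1 := by
    rw [hχdef]; exact ballCutoff_eq_one hr (by rw [sub_self, norm_zero]; positivity)
  have hDχ : ∀ z, ‖fderiv ℝ χ z‖ ≤ 3 * C₀ * R⁻¹ := by
    intro z
    have h := hC₀ y (R / 3) hr z
    rw [← hχdef] at h
    calc ‖fderiv ℝ χ z‖ ≤ C₀ / (R / 3) := h
      _ = 3 * C₀ * R⁻¹ := by rw [div_div_eq_mul_div, div_eq_mul_inv]; ring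
  have hD2χ : ∀ z, ‖iteratedFDeriv ℝ 2 χ z‖ ≤ 9 * C₂ * (R ^ 2)⁻¹ := by
    intro z
    have h := hC₂ y (R / 3) hr z
    rw [← hχdef] at h
    calc ‖iteratedFDeriv ℝ 2 χ z‖ ≤ C₂ / (R / 3) ^ 2 := h
      _ = 9 * C₂ * (R ^ 2)⁻¹ := by rw [div_pow, div_div_eq_mul_div, div_eq_mul_inv]; ring
  -- off the shell `B̄(y,R) \ B(y,2R/3)` the cutoff is locally constant
  have hoff : ∀ z, z ∉ closedBall y R \ ball y (2 * (R / 3)) →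
      fderiv ℝ χ z = 0 ∧ iteratedFDeriv ℝ 2 χ z = 0 := by
    intro z hz
    rw [Set.mem_sdiff, not_and, not_not] at hz
    by_cases h1 : z ∈ closedBall y R
    · have h2 := hz h1
      rw [hχdef]
      exact ⟨fderiv_ballCutoff_eq_zero_of_mem hr h2, iteratedFDeriv_two_ballCutoff_eq_zero_of_mem hr h2⟩
    · have h1' : z ∉ closedBall y (3 * (R / 3)) := by rwa [show 3 * (R / 3) = R by ring]
      rw [hχdef]
      exact ⟨fderiv_ballCutoff_eq_zero_of_notMem hr h1',
        iteratedFDeriv_two_ballCutoff_eq_zero_of_notMem hr h1'⟩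
  have hcase : ∀ z, (z ∈ closedBall y R ∧ 2 * (R / 3) ≤ ‖y - z‖) ∨
      (fderiv ℝ χ z = 0 ∧ iteratedFDeriv ℝ 2 χ z = 0) := by
    intro z
    by_cases hz : z ∈ closedBall y R \ ball y (2 * (R / 3))
    · refine Or.inl ⟨hz.1, ?_⟩
      have h2 := hz.2
      rw [mem_ball, dist_eq_norm, norm_sub_rev, not_lt] at h2
      exact h2
    · exact Or.inr (hoff z hz)
  -- kernel bounds on the shell
  have hΓ : ∀ z, 2 * (R / 3) ≤ ‖y - z‖ → |newtonKernel (y - z)| ≤ R⁻¹ := by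
    intro z hz
    have hpos : 0 < ‖y - z‖ := lt_of_lt_of_le (by positivity) hz
    rw [abs_newtonKernel, inv_le_inv₀ (by positivity) hR]
    nlinarith [Real.pi_gt_three, norm_nonneg (y - z)]
  have hDΓ : ∀ z, 2 * (R / 3) ≤ ‖y - z‖ → ‖fderiv ℝ newtonKernel (y - z)‖ ≤ (R ^ 2)⁻¹ := by
    intro z hz
    have hpos : 0 < ‖y - z‖ := lt_of_lt_of_le (by positivity) hz
    refine (norm_fderiv_newtonKernel_le _).trans ?_
    rw [inv_le_inv₀ (by positivity) (by positivity)]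
    have h2 : (2 * (R / 3)) ^ 2 ≤ ‖y - z‖ ^ 2 := pow_le_pow_left₀ (by positivity) hz 2
    nlinarith [Real.pi_gt_three, sq_nonneg ‖y - z‖]
  -- the orthonormal frame and the first-order coefficients `a i = ∂_i χ`
  set b := stdOrthonormalBasis ℝ (EuclideanSpace ℝ (Fin 3)) with hb
  have hbn : ∀ i, ‖b i‖ = 1 := fun i => b.orthonormal.1 i
  obtain ⟨a, ha⟩ : ∃ a : Fin (Module.finrank ℝ (EuclideanSpace ℝ (Fin 3))) → (EuclideanSpace ℝ (Fin 3)) → ℝ, a = fun i z => fderiv ℝ χ z (b i) :=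
    ⟨_, rfl⟩
  -- smoothness bookkeeping
  have hv1 : ContDiff ℝ 1 v := hv.of_le (by norm_num)
  have hvc : Continuous v := hv.continuous
  have hvd : ∀ z, DifferentiableAt ℝ v z := fun z => (hv.differentiable (by norm_num)) z
  have hω1 : ContDiff ℝ 1 (curl v) := contDiff_curl (n := 1) (by exact hv)
  have hωc : Continuous (curl v) := hω1.continuous
  have hDχ1 : ContDiff ℝ 1 (fderiv ℝ χ) := hχ2.fderiv_right (m := 1) (by norm_num)
  have hDχd : ∀ z, DifferentiableAt ℝ (fderiv ℝ χ) z := fun z => (hDχ1.differentiable one_ne_zero) z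
  have ha1 : ∀ i, ContDiff ℝ 1 (a i) := fun i => by rw [ha]; exact hDχ1.clm_apply contDiff_const
  have hac : ∀ i, Continuous (a i) := fun i => (ha1 i).continuous
  have had : ∀ i z, DifferentiableAt ℝ (a i) z := fun i z => ((ha1 i).differentiable one_ne_zero) z
  have has : ∀ i, HasCompactSupport (a i) := fun i => by
    rw [ha]; exact hχc.fderiv_apply (𝕜 := ℝ) (b i)
  have hDv : ∀ i, Continuous fun z => fderiv ℝ v z (b i) := fun i =>
    (hv.continuous_fderiv two_ne_zero).clm_apply continuous_const
  have haz : ∀ i z, a i z = fderiv ℝ χ z (b i) := fun i z => by rw [ha]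
  -- `Φ_i = a_i • v` and its derivative along `b i`
  have hΦ1 : ∀ i, ContDiff ℝ 1 (fun z => a i z • v z) := fun i => (ha1 i).smul hv1
  have hΦs : ∀ i, HasCompactSupport (fun z => a i z • v z) := fun i => (has i).smul_right
  have hDΦ : ∀ i z, fderiv ℝ (fun z => a i z • v z) z (b i) =
      a i z • fderiv ℝ v z (b i) + (fderiv ℝ (a i) z (b i)) • v z := by
    intro i z
    rw [fderiv_fun_smul (had i z) (hvd z)]
    simp [ContinuousLinearMap.smulRight_apply]
  have hDa : ∀ i z, fderiv ℝ (a i) z (b i) = iteratedFDeriv ℝ 2 χ z ![b i, b i] := by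
    intro i z
    rw [iteratedFDeriv_two_apply, ha]
    simp only
    rw [fderiv_clm_apply (hDχd z) (differentiableAt_const _)]
    simp
  have hDa_le : ∀ i z, |fderiv ℝ (a i) z (b i)| ≤ ‖iteratedFDeriv ℝ 2 χ z‖ := fun i z => by
    rw [hDa]; exact abs_iteratedFDeriv_two_apply_le χ z (b i) (b i) (hbn i) (hbn i)
  have ha_le : ∀ i z, |a i z| ≤ ‖fderiv ℝ χ z‖ := fun i z => by
    rw [haz, ← Real.norm_eq_abs]
    exact ((fderiv ℝ χ z).le_opNorm (b i)).trans (by rw [hbn, mul_one])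
  -- the lower-order density `G` and the representation at the centre
  obtain ⟨G, hGdef⟩ : ∃ G : (EuclideanSpace ℝ (Fin 3)) → (EuclideanSpace ℝ (Fin 3)),
      G = fun z => (Δ (fun w => χ w • v w)) z + curl (fun w => χ w • curl v w) z := ⟨_, rfl⟩
  have hU2 : ContDiff ℝ 2 (fun w => χ w • v w) := hχ2.smul hv
  have hUc : HasCompactSupport (fun w => χ w • v w) := hχc.smul_right
  have hΨ1 : ContDiff ℝ 1 (fun w => χ w • curl v w) := hχ1.smul hω1
  have hΨc : HasCompactSupport (fun w => χ w • curl v w) := hχc.smul_right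
  have hGc : Continuous G := by
    rw [hGdef]
    exact (contDiff_laplacian (n := 0) (by exact hU2)).continuous.add (continuous_curl hΨ1)
  have hGs : HasCompactSupport G := by
    rw [hGdef]
    refine HasCompactSupport.add ?_ (hasCompactSupport_curl hΨc)
    exact HasCompactSupport.of_support_subset_isCompact hUc.isCompact fun z hz => by
      by_contra h
      exact hz (laplacian_eq_zero_of_notMem_tsupport h)
  have hrep : v y - biotSavart (cutVorticity v y R) y = ∫ z, newtonKernel (y - z) • G z := by
    have h := smul_eq_biotSavart_add_integral_newtonKernel hv hχ2 hχc y
    rw [hχy, one_smul] at h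
    have hcut : (fun w => χ w • curl v w) = cutVorticity v y R := by
      funext w; rw [hχdef]; rfl
    rw [← hcut, h, add_sub_cancel_left, hGdef]
  -- the first-order part `T = 2 Σ_i a_i • ∂_i v` of the density
  obtain ⟨T, hTdef⟩ : ∃ T : (EuclideanSpace ℝ (Fin 3)) → (EuclideanSpace ℝ (Fin 3)),
      T = fun z => (2 : ℝ) • ∑ i, a i z • fderiv ℝ v z (b i) := ⟨_, rfl⟩
  have hTc : Continuous T := by
    rw [hTdef]
    exact (continuous_finsetSum Finset.univ (fun i _ => (hac i).smul (hDv i))).const_smul (2 : ℝ)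
  have hTs : HasCompactSupport T := by
    rw [hTdef]
    refine HasCompactSupport.intro (isCompact_closedBall y R) fun z hz => ?_
    have h0 : fderiv ℝ χ z = 0 := (hoff z (fun h => hz h.1)).1
    simp [haz, h0]
  have hdens : ∀ z, G z =
      curlCLM ((fderiv ℝ χ z).smulRight (curl v z)) + T z + ((Δ χ) z) • v z := by
    intro z
    rw [hGdef, hTdef]
    simp only [haz]
    exact laplacian_smul_add_curl_smul_curl_eq hv hχ2 (Or.inr (Eventually.of_forall hdiv))
  have hPdens : ∀ z, G z - T z =
      curlCLM ((fderiv ℝ χ z).smulRight (curl v z)) + ((Δ χ) z) • v z := by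
    intro z; rw [hdens z]; abel
  have hPc : Continuous fun z => G z - T z := hGc.sub hTc
  have hPs : HasCompactSupport fun z => G z - T z := hGs.sub hTs
  -- splitting the Newtonian integral
  have hIP : Integrable fun z => newtonKernel (y - z) • (G z - T z) :=
    integrable_newtonKernel_smul hPc hPs y
  have hIT : Integrable fun z => newtonKernel (y - z) • T z := integrable_newtonKernel_smul hTc hTs y
  have hsplit : ∫ z, newtonKernel (y - z) • G z =
      (∫ z, newtonKernel (y - z) • (G z - T z)) + ∫ z, newtonKernel (y - z) • T z := by
    rw [← integral_add hIP hIT]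
    congr 1; funext z; rw [← smul_add, sub_add_cancel]
  have hIi : ∀ i, Integrable fun z => newtonKernel (y - z) • (a i z • fderiv ℝ v z (b i)) :=
    fun i => integrable_newtonKernel_smul ((hac i).smul (hDv i)) ((has i).smul_right) y
  have hTint : ∫ z, newtonKernel (y - z) • T z =
      (2 : ℝ) • ∑ i, ∫ z, newtonKernel (y - z) • (a i z • fderiv ℝ v z (b i)) := by
    rw [← integral_finsetSum _ (fun i _ => hIi i), ← integral_smul]
    congr 1; funext z
    rw [hTdef]; simp only
    rw [smul_comm (newtonKernel (y - z)) (2 : ℝ), Finset.smul_sum]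
  -- integration by parts, one index at a time
  have hIBP : ∀ i, ∫ z, newtonKernel (y - z) • (a i z • fderiv ℝ v z (b i)) =
      (∫ z, (fderiv ℝ newtonKernel (y - z) (b i)) • (a i z • v z)) -
        ∫ z, newtonKernel (y - z) • ((fderiv ℝ (a i) z (b i)) • v z) := by
    intro i
    have h1 := integral_newtonKernel_smul_fderiv_eq (hΦ1 i) (hΦs i) y (b i)
    have hI2 : Integrable fun z => newtonKernel (y - z) • ((fderiv ℝ (a i) z (b i)) • v z) :=
      integrable_newtonKernel_smul
        ((((ha1 i).continuous_fderiv one_ne_zero).clm_apply continuous_const).smul hvc)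
        (((has i).fderiv_apply (𝕜 := ℝ) (b i)).smul_right) y
    have hI1 : Integrable fun z => newtonKernel (y - z) • fderiv ℝ (fun z => a i z • v z) z (b i) :=
      integrable_newtonKernel_smul (((hΦ1 i).continuous_fderiv one_ne_zero).clm_apply continuous_const)
        ((hΦs i).fderiv_apply (𝕜 := ℝ) (b i)) y
    rw [← h1, ← integral_sub hI1 hI2]
    congr 1; funext z; rw [hDΦ i z, smul_add, add_sub_cancel_right]
  -- the majorants
  obtain ⟨mV, hmVdef⟩ : ∃ mV : (EuclideanSpace ℝ (Fin 3)) → ℝ, mV = (closedBall y R).indicator fun z => ‖v z‖ := ⟨_, rfl⟩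
  obtain ⟨mW, hmWdef⟩ : ∃ mW : (EuclideanSpace ℝ (Fin 3)) → ℝ, mW = (closedBall y R).indicator fun z => ‖curl v z‖ :=
    ⟨_, rfl⟩
  have hmVi : Integrable mV := by
    rw [hmVdef, integrable_indicator_iff measurableSet_closedBall]
    exact hvc.norm.continuousOn.integrableOn_compact (isCompact_closedBall y R)
  have hmWi : Integrable mW := by
    rw [hmWdef, integrable_indicator_iff measurableSet_closedBall]
    exact hωc.norm.continuousOn.integrableOn_compact (isCompact_closedBall y R)
  have hmV0 : ∀ z, 0 ≤ mV z := fun z => by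
    rw [hmVdef]; exact indicator_nonneg (fun _ _ => norm_nonneg _) _
  have hmW0 : ∀ z, 0 ≤ mW z := fun z => by
    rw [hmWdef]; exact indicator_nonneg (fun _ _ => norm_nonneg _) _
  have hmVin : ∀ z ∈ closedBall y R, mV z = ‖v z‖ := fun z hz => by
    rw [hmVdef, indicator_of_mem hz]
  have hmWin : ∀ z ∈ closedBall y R, mW z = ‖curl v z‖ := fun z hz => by
    rw [hmWdef, indicator_of_mem hz]
  have hae : closedBall y R =ᵐ[volume] ball y R :=
    (ae_eq_of_subset_of_measure_ge ball_subset_closedBall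
      (Measure.addHaar_closedBall_eq_addHaar_ball volume y R).le
      measurableSet_ball.nullMeasurableSet measure_closedBall_lt_top.ne).symm
  have hmVint : ∫ z, mV z = ∫ z in ball y R, ‖v z‖ := by
    rw [hmVdef, integral_indicator measurableSet_closedBall, setIntegral_congr_set hae]
  have hmWint : ∫ z, mW z = ∫ z in ball y R, ‖curl v z‖ := by
    rw [hmWdef, integral_indicator measurableSet_closedBall, setIntegral_congr_set hae]
  -- pointwise bounds
  have hsr0 : ∀ w : (EuclideanSpace ℝ (Fin 3)), (0 : (EuclideanSpace ℝ (Fin 3)) →L[ℝ] ℝ).smulRight w = 0 := fun w => by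
    ext u; simp
  have hP1 : ∀ z, ‖newtonKernel (y - z) • (G z - T z)‖ ≤
      (3 * ‖curlCLM‖ * C₀ * (R ^ 2)⁻¹) * mW z + (27 * C₂ * (R ^ 3)⁻¹) * mV z := by
    intro z
    rcases hcase z with ⟨hz, hdist⟩ | ⟨h0, h00⟩
    · rw [hmVin z hz, hmWin z hz, norm_smul, Real.norm_eq_abs, hPdens z]
      have hG1 : ‖curlCLM ((fderiv ℝ χ z).smulRight (curl v z))‖ ≤
          ‖curlCLM‖ * (3 * C₀ * R⁻¹) * ‖curl v z‖ := by
        have e1 : ‖curlCLM ((fderiv ℝ χ z).smulRight (curl v z))‖ ≤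
            ‖curlCLM‖ * ‖(fderiv ℝ χ z).smulRight (curl v z)‖ := ContinuousLinearMap.le_opNorm _ _
        rw [ContinuousLinearMap.norm_smulRight_apply] at e1
        have e2 : ‖curlCLM‖ * (‖fderiv ℝ χ z‖ * ‖curl v z‖) ≤ ‖curlCLM‖ * ((3 * C₀ * R⁻¹) * ‖curl v z‖) :=
          mul_le_mul_of_nonneg_left (mul_le_mul_of_nonneg_right (hDχ z) (norm_nonneg _)) hκ0
        calc _ ≤ _ := e1
          _ ≤ _ := e2
          _ = ‖curlCLM‖ * (3 * C₀ * R⁻¹) * ‖curl v z‖ := by ring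
      have hG3 : ‖((Δ χ) z) • v z‖ ≤ 3 * (9 * C₂ * (R ^ 2)⁻¹) * ‖v z‖ := by
        rw [norm_smul, Real.norm_eq_abs]
        have e3 : |(Δ χ) z| ≤ 3 * (9 * C₂ * (R ^ 2)⁻¹) :=
          (abs_laplacian_le_three_mul_norm_iteratedFDeriv χ z).trans
            (mul_le_mul_of_nonneg_left (hD2χ z) (by norm_num))
        exact mul_le_mul_of_nonneg_right e3 (norm_nonneg _)
      have hsum := (norm_add_le _ _).trans (add_le_add hG1 hG3)
      have hΓz := hΓ z hdist
      have step : |newtonKernel (y - z)| *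
          ‖curlCLM ((fderiv ℝ χ z).smulRight (curl v z)) + ((Δ χ) z) • v z‖ ≤
          R⁻¹ * (‖curlCLM‖ * (3 * C₀ * R⁻¹) * ‖curl v z‖ + 3 * (9 * C₂ * (R ^ 2)⁻¹) * ‖v z‖) :=
        mul_le_mul hΓz hsum (norm_nonneg _) (inv_nonneg.2 hR.le)
      have e4 : R⁻¹ * (‖curlCLM‖ * (3 * C₀ * R⁻¹) * ‖curl v z‖ + 3 * (9 * C₂ * (R ^ 2)⁻¹) * ‖v z‖) =
          (3 * ‖curlCLM‖ * C₀ * (R ^ 2)⁻¹) * ‖curl v z‖ + (27 * C₂ * (R ^ 3)⁻¹) * ‖v z‖ := by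
        have e5 : (R ^ 2)⁻¹ = R⁻¹ * R⁻¹ := by rw [sq, mul_inv]
        have e6 : (R ^ 3)⁻¹ = R⁻¹ * (R⁻¹ * R⁻¹) := by rw [pow_succ, pow_two, mul_inv, mul_inv]; ring
        rw [e5, e6]; ring
      rw [← e4]; exact step
    · have hΔ : (Δ χ) z = 0 := by
        have h3 := abs_laplacian_le_three_mul_norm_iteratedFDeriv χ z
        rw [h00, norm_zero, mul_zero] at h3
        exact abs_eq_zero.1 (le_antisymm h3 (abs_nonneg _))
      have hP0 : G z - T z = 0 := by
        rw [hPdens z, h0, hΔ, hsr0, map_zero, zero_smul, add_zero]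
      rw [hP0, smul_zero, norm_zero]
      exact add_nonneg (mul_nonneg (by positivity) (hmW0 z)) (mul_nonneg (by positivity) (hmV0 z))
  have hP2 : ∀ i z, ‖(fderiv ℝ newtonKernel (y - z) (b i)) • (a i z • v z)‖ ≤
      (3 * C₀ * (R ^ 3)⁻¹) * mV z := by
    intro i z
    rcases hcase z with ⟨hz, hdist⟩ | ⟨h0, h00⟩
    · rw [hmVin z hz, norm_smul, norm_smul, Real.norm_eq_abs, Real.norm_eq_abs]
      have h1 : |fderiv ℝ newtonKernel (y - z) (b i)| ≤ (R ^ 2)⁻¹ := by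
        rw [← Real.norm_eq_abs]
        exact ((fderiv ℝ newtonKernel (y - z)).le_opNorm (b i)).trans
          (by rw [hbn, mul_one]; exact hDΓ z hdist)
      have h2 : |a i z| ≤ 3 * C₀ * R⁻¹ := (ha_le i z).trans (hDχ z)
      calc |fderiv ℝ newtonKernel (y - z) (b i)| * (|a i z| * ‖v z‖)
          ≤ (R ^ 2)⁻¹ * ((3 * C₀ * R⁻¹) * ‖v z‖) := by gcongr
        _ = (3 * C₀ * (R ^ 3)⁻¹) * ‖v z‖ := by ring
    · have : a i z = 0 := by rw [haz, h0]; simp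
      rw [this, zero_smul, smul_zero, norm_zero]
      have := hmV0 z; positivity
  have hP3 : ∀ i z, ‖newtonKernel (y - z) • ((fderiv ℝ (a i) z (b i)) • v z)‖ ≤
      (9 * C₂ * (R ^ 3)⁻¹) * mV z := by
    intro i z
    rcases hcase z with ⟨hz, hdist⟩ | ⟨h0, h00⟩
    · rw [hmVin z hz, norm_smul, norm_smul, Real.norm_eq_abs, Real.norm_eq_abs]
      have h1 := hΓ z hdist
      have h2 : |fderiv ℝ (a i) z (b i)| ≤ 9 * C₂ * (R ^ 2)⁻¹ := (hDa_le i z).trans (hD2χ z)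
      calc |newtonKernel (y - z)| * (|fderiv ℝ (a i) z (b i)| * ‖v z‖)
          ≤ R⁻¹ * ((9 * C₂ * (R ^ 2)⁻¹) * ‖v z‖) := by gcongr
        _ = (9 * C₂ * (R ^ 3)⁻¹) * ‖v z‖ := by ring
    · have : fderiv ℝ (a i) z (b i) = 0 := by rw [hDa, h00]; simp
      rw [this, zero_smul, smul_zero, norm_zero]
      have := hmV0 z; positivity
  -- integrate the bounds
  have hPbound : ‖∫ z, newtonKernel (y - z) • (G z - T z)‖ ≤
      (3 * ‖curlCLM‖ * C₀ * (R ^ 2)⁻¹) * (∫ z in ball y R, ‖curl v z‖) +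
        (27 * C₂ * (R ^ 3)⁻¹) * (∫ z in ball y R, ‖v z‖) := by
    have hgi : Integrable fun z => (3 * ‖curlCLM‖ * C₀ * (R ^ 2)⁻¹) * mW z + (27 * C₂ * (R ^ 3)⁻¹) * mV z :=
      (hmWi.const_mul _).add (hmVi.const_mul _)
    have h := norm_integral_le_of_norm_le hgi (Eventually.of_forall hP1)
    rw [integral_add (hmWi.const_mul _) (hmVi.const_mul _), integral_const_mul, integral_const_mul,
      hmVint, hmWint] at h
    exact h
  have hTi_bound : ∀ i, ‖∫ z, newtonKernel (y - z) • (a i z • fderiv ℝ v z (b i))‖ ≤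
      (3 * C₀ + 9 * C₂) * (R ^ 3)⁻¹ * ∫ z in ball y R, ‖v z‖ := by
    intro i
    rw [hIBP i]
    refine (norm_sub_le _ _).trans ?_
    have h2 := norm_integral_le_of_norm_le (hmVi.const_mul (3 * C₀ * (R ^ 3)⁻¹))
      (Eventually.of_forall (hP2 i))
    have h3 := norm_integral_le_of_norm_le (hmVi.const_mul (9 * C₂ * (R ^ 3)⁻¹))
      (Eventually.of_forall (hP3 i))
    rw [integral_const_mul, hmVint] at h2 h3
    calc _ ≤ _ := add_le_add h2 h3
      _ = (3 * C₀ + 9 * C₂) * (R ^ 3)⁻¹ * ∫ z in ball y R, ‖v z‖ := by ring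
  have hcard : (Finset.univ : Finset (Fin (Module.finrank ℝ (EuclideanSpace ℝ (Fin 3))))).card = 3 := by
    rw [Finset.card_univ, Fintype.card_fin, finrank_euclideanSpace, Fintype.card_fin]
  have hTbound : ‖∫ z, newtonKernel (y - z) • T z‖ ≤
      (18 * C₀ + 54 * C₂) * (R ^ 3)⁻¹ * ∫ z in ball y R, ‖v z‖ := by
    rw [hTint, norm_smul, Real.norm_eq_abs, abs_two]
    calc 2 * ‖∑ i, ∫ z, newtonKernel (y - z) • (a i z • fderiv ℝ v z (b i))‖
        ≤ 2 * ∑ i, ‖∫ z, newtonKernel (y - z) • (a i z • fderiv ℝ v z (b i))‖ := by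
          gcongr; exact norm_sum_le _ _
      _ ≤ 2 * ∑ _i : Fin (Module.finrank ℝ (EuclideanSpace ℝ (Fin 3))),
            (3 * C₀ + 9 * C₂) * (R ^ 3)⁻¹ * ∫ z in ball y R, ‖v z‖ := by
          gcongr with i _
          exact hTi_bound i
      _ = (18 * C₀ + 54 * C₂) * (R ^ 3)⁻¹ * ∫ z in ball y R, ‖v z‖ := by
          rw [Finset.sum_const, hcard, nsmul_eq_mul]; push_cast; ring
  -- assemble
  have IV0 : 0 ≤ ∫ z in ball y R, ‖v z‖ := setIntegral_nonneg measurableSet_ball fun _ _ => norm_nonneg _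
  have IW0 : 0 ≤ ∫ z in ball y R, ‖curl v z‖ :=
    setIntegral_nonneg measurableSet_ball fun _ _ => norm_nonneg _
  have hX : 0 ≤ (R ^ 3)⁻¹ * ∫ z in ball y R, ‖v z‖ := mul_nonneg (by positivity) IV0
  have hY : 0 ≤ (R ^ 2)⁻¹ * ∫ z in ball y R, ‖curl v z‖ := mul_nonneg (by positivity) IW0
  rw [hrep, hsplit]
  calc ‖(∫ z, newtonKernel (y - z) • (G z - T z)) + ∫ z, newtonKernel (y - z) • T z‖
      ≤ ‖∫ z, newtonKernel (y - z) • (G z - T z)‖ + ‖∫ z, newtonKernel (y - z) • T z‖ :=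
        norm_add_le _ _
    _ ≤ _ := add_le_add hPbound hTbound
    _ ≤ (1 + 81 * C₂ + 18 * C₀ + 3 * ‖curlCLM‖ * C₀) *
          ((R ^ 3)⁻¹ * (∫ x in ball y R, ‖v x‖) + (R ^ 2)⁻¹ * (∫ x in ball y R, ‖curl v x‖)) := by
        nlinarith [mul_nonneg (mul_nonneg hκ0 hC₀0) hX, mul_nonneg hC₂0 hY, mul_nonneg hC₀0 hY,
          mul_nonneg hC₂0 hX, mul_nonneg hC₀0 hX, mul_nonneg (mul_nonneg hκ0 hC₀0) hY, hX, hY]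

end ShellKernel

/-- H2♭ — the stub of v1.2/v1.3 — is DISCHARGED (v1.4): kept under its registered name for the kernel products. -/
theorem stub_shellKernelBound : ShellKernelBound := shellKernelBound_holds

/-- H2, a consequence of H2♭ (v1.2); a THEOREM since v1.4. -/
theorem stub_harmonicRemainder : HarmonicRemainder :=
  harmonicRemainder_of_shellKernelBound stub_shellKernelBound

/-! ### §2 KERNEL: `HelmholtzNearField → HarmonicRemainder → VorticalCentre` (proved) -/

/-- **Sb by kernel.**  The `(Γ₂, ρ, δ)` choice of the Sb docstring, done once over H1/H2. -/
theorem vorticalCentre_of_stubs (h₁ : HelmholtzNearField) (h₂ : HarmonicRemainder) : VorticalCentre := by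
  obtain ⟨C₁, hC₁, h₁⟩ := h₁
  obtain ⟨C₂, hC₂, h₂⟩ := h₂
  intro ε M₁ C₀ hε hM₁
  have hC₁0 : 0 < C₁ := by linarith
  have hC₂0 : 0 < C₂ := by linarith
  have hM₁0 : 0 < M₁ := by linarith
  -- the parameters
  set S : ℝ := Real.sqrt |C₀| with hSdef
  have hS0 : 0 ≤ S := Real.sqrt_nonneg _
  set Γ₂ : ℝ := 3 + 4 * C₂ * S / ε with hΓ₂def
  have hΓ₂3 : 3 ≤ Γ₂ := by
    have : 0 ≤ 4 * C₂ * S / ε := by positivity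
    linarith
  have hΓ₂0 : 0 < Γ₂ := by linarith
  set ρ₀ : ℝ := min 1 (ε / (4 * C₁ * M₁)) with hρ₀def
  have hρ₀0 : 0 < ρ₀ := lt_min one_pos (by positivity)
  have hρ₀1 : ρ₀ ≤ 1 := min_le_left _ _
  have hρ₀ε : ρ₀ ≤ ε / (4 * C₁ * M₁) := min_le_right _ _
  -- `δ` is chosen LAST: it absorbs `Γ₂³` (far field of H1 at radius `R = Γ₂σ`) and `ρ₀⁻⁴`
  set q : ℝ := ε * ρ₀ ^ 2 / (4 * (C₁ + C₂)) with hqdef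
  have hq0 : 0 < q := by positivity
  set δ : ℝ := q ^ 2 / Γ₂ ^ 3 with hδdef
  have hδ0 : 0 < δ := by positivity
  refine ⟨Γ₂, δ, by linarith, hδ0, ?_⟩
  intro v y σ hσ hv hdiv hC2 hE hhot
  -- radii
  set R : ℝ := Γ₂ * σ with hRdef
  have hR0 : 0 < R := mul_pos hΓ₂0 hσ
  set ρ : ℝ := σ * ρ₀ with hρdef
  have hρ0 : 0 < ρ := mul_pos hσ hρ₀0
  have hρσ : ρ ≤ σ := by
    have : σ * ρ₀ ≤ σ * 1 := by gcongr
    simpa [hρdef] using this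
  have h3ρR : 3 * ρ ≤ R := by
    have : 3 * σ ≤ Γ₂ * σ := by gcongr
    linarith
  have hρR : ρ ≤ R := by linarith
  -- contradiction hypothesis: small enstrophy `W = δ/σ`
  by_contra hnot
  have hWle : ∫⁻ x in ball y (Γ₂ * σ), ‖curl v x‖ₑ ^ 2 ≤ ENNReal.ofReal (δ / σ) := le_of_lt (not_le.mp hnot)
  have hW0 : 0 ≤ δ / σ := by positivity
  -- energy with `|C₀|`
  have hE' : ∫⁻ x in ball y (Γ₂ * σ), ENNReal.ofReal (‖v x‖ ^ 2) ≤ ENNReal.ofReal (|C₀| * (Γ₂ * σ)) :=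
    hE.trans (ENNReal.ofReal_le_ofReal (mul_le_mul_of_nonneg_right (le_abs_self C₀) hR0.le))
  have hE0 : 0 ≤ |C₀| * (Γ₂ * σ) := by positivity
  -- the first-derivative bound on `B(y,ρ) ⊆ B(y,σ)` from the `C²` hypothesis at `j = 1`
  set L : ℝ := M₁ * σ ^ (-(((1 : ℕ) : ℝ) + 1)) with hLdef
  have hL : ∀ x ∈ ball y ρ, ‖iteratedFDeriv ℝ 1 v x‖ ≤ L := fun x hx =>
    hC2 x (ball_subset_ball hρσ hx) 1 (by norm_num)
  have hLval : L = M₁ / σ ^ 2 := by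
    have : σ ^ (-(((1 : ℕ) : ℝ) + 1)) = (σ ^ 2)⁻¹ := by
      rw [show (-(((1 : ℕ) : ℝ) + 1)) = -(2 : ℝ) by norm_num, Real.rpow_neg hσ.le, Real.rpow_two]
    rw [hLdef, this, div_eq_mul_inv]
  -- H1 and H2 at the centre
  have hnear := h₁ v hv y ρ R L (δ / σ) hρ0 h3ρR hL hWle hW0
  have hrem := h₂ v hv hdiv y R (|C₀| * (Γ₂ * σ)) (δ / σ) hR0 hE' hE0 hWle hW0
  -- term 1: `C₁ ρ L ≤ ε/(4σ)`
  have hT1 : C₁ * (ρ * L) ≤ ε / (4 * σ) := by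
    rw [hLval, hρdef]
    have hσ2 : 0 < σ ^ 2 := by positivity
    have hkey : C₁ * ρ₀ * M₁ ≤ ε / 4 := by
      calc C₁ * ρ₀ * M₁ ≤ C₁ * (ε / (4 * C₁ * M₁)) * M₁ := by gcongr
        _ = ε / 4 := by field_simp
    rw [show C₁ * (σ * ρ₀ * (M₁ / σ ^ 2)) = C₁ * ρ₀ * M₁ / σ by field_simp]
    rw [div_le_div_iff₀ hσ (by positivity)]
    nlinarith [hkey, hσ]
  -- term 2: `C₂ √(E/R³) ≤ ε/(4σ)` by the choice of `Γ₂`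
  have hT2 : C₂ * Real.sqrt (|C₀| * (Γ₂ * σ) / R ^ 3) ≤ ε / (4 * σ) := by
    have hq : |C₀| * (Γ₂ * σ) / R ^ 3 = (S / R) ^ 2 := by
      rw [div_pow, Real.sq_sqrt (abs_nonneg C₀), hRdef]
      field_simp
    rw [hq, Real.sqrt_sq (by positivity)]
    have hΓε : ε * Γ₂ = 3 * ε + 4 * C₂ * S := by
      rw [hΓ₂def]; field_simp
    rw [hRdef, show C₂ * (S / (Γ₂ * σ)) = C₂ * S / (Γ₂ * σ) by ring,
      div_le_div_iff₀ (by positivity) (by positivity)]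
    nlinarith [hΓε, hσ, hε, hC₂0, hS0]
  -- term 3: H1's far field `C₁ √(R³W)/ρ² = C₁ q/((C₁+C₂)… )`: `√(R³·δ/σ) = σ q`, `/ρ² = q/(ρ₀²σ)`
  have hfar : Real.sqrt (R ^ 3 * (δ / σ)) / ρ ^ 2 = ε / (4 * (C₁ + C₂) * σ) := by
    have h1 : R ^ 3 * (δ / σ) = (σ * q) ^ 2 := by
      rw [hδdef, hRdef]; field_simp
    rw [h1, Real.sqrt_sq (by positivity), hρdef, hqdef]
    field_simp
  -- term 4: H2's enstrophy term `C₂ √(W/R) = C₂ q/(Γ₂²σ) ≤ C₂ ε/(4(C₁+C₂)σ)`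
  have hWR : Real.sqrt (δ / σ / R) = q / (Γ₂ ^ 2 * σ) := by
    have h1 : δ / σ / R = (q / (Γ₂ ^ 2 * σ)) ^ 2 := by
      rw [hδdef, hRdef]; field_simp
    rw [h1, Real.sqrt_sq (by positivity)]
  have hWR' : q / (Γ₂ ^ 2 * σ) ≤ ε / (4 * (C₁ + C₂) * σ) := by
    have hΓsq : (1 : ℝ) ≤ Γ₂ ^ 2 := one_le_pow₀ (by linarith)
    have hρ₀sq : ρ₀ ^ 2 ≤ 1 := pow_le_one₀ hρ₀0.le hρ₀1
    have hqle : q ≤ ε / (4 * (C₁ + C₂)) :=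
      calc q = ε * ρ₀ ^ 2 / (4 * (C₁ + C₂)) := hqdef
        _ ≤ ε * 1 / (4 * (C₁ + C₂)) := by gcongr
        _ = ε / (4 * (C₁ + C₂)) := by rw [mul_one]
    have hden : σ ≤ Γ₂ ^ 2 * σ := le_mul_of_one_le_left hσ.le hΓsq
    calc q / (Γ₂ ^ 2 * σ) ≤ q / σ := div_le_div_of_nonneg_left hq0.le hσ hden
      _ ≤ (ε / (4 * (C₁ + C₂))) / σ := by gcongr
      _ = ε / (4 * (C₁ + C₂) * σ) := by rw [div_div]
  have hT34 : C₁ * (Real.sqrt (R ^ 3 * (δ / σ)) / ρ ^ 2) + C₂ * Real.sqrt (δ / σ / R) ≤ ε / (4 * σ) := by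
    rw [hfar, hWR]
    calc C₁ * (ε / (4 * (C₁ + C₂) * σ)) + C₂ * (q / (Γ₂ ^ 2 * σ))
        ≤ C₁ * (ε / (4 * (C₁ + C₂) * σ)) + C₂ * (ε / (4 * (C₁ + C₂) * σ)) := by gcongr
      _ = ε / (4 * σ) := by field_simp
  -- assemble
  have hvy : ‖v y‖ ≤ ε / (4 * σ) + ε / (4 * σ) + ε / (4 * σ) := by
    have hsplit : ‖v y‖ ≤ ‖v y - biotSavart (cutVorticity v y R) y‖ + ‖biotSavart (cutVorticity v y R) y‖ := by
      calc ‖v y‖ = ‖(v y - biotSavart (cutVorticity v y R) y) + biotSavart (cutVorticity v y R) y‖ := by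
            rw [sub_add_cancel]
        _ ≤ _ := norm_add_le _ _
    have h1' : ‖biotSavart (cutVorticity v y R) y‖ ≤
        C₁ * (ρ * L) + C₁ * (Real.sqrt (R ^ 3 * (δ / σ)) / ρ ^ 2) := by
      have := hnear; rw [mul_add] at this; exact this
    have h2' : ‖v y - biotSavart (cutVorticity v y R) y‖ ≤
        C₂ * Real.sqrt (|C₀| * (Γ₂ * σ) / R ^ 3) + C₂ * Real.sqrt (δ / σ / R) := by
      have := hrem; rw [mul_add] at this; exact this
    linarith [hsplit, h1', h2', hT1, hT2, hT34]
  have hfin : σ * ‖v y‖ ≤ ε := by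
    calc σ * ‖v y‖ ≤ σ * (ε / (4 * σ) + ε / (4 * σ) + ε / (4 * σ)) := by gcongr
      _ = 3 * ε / 4 := by field_simp; ring
      _ ≤ ε := by linarith
  linarith [hhot, hfin]

/-! ### §3 Products BY NAME (what Sb feeds) -/

/-- **Sb of record — PROVED outright since v1.4** (H1 v1.1, H2 ⟸ H2♭ v1.2, H2♭ v1.4). -/
theorem vorticalCentre_via_stubs : VorticalCentre :=
  vorticalCentre_of_stubs helmholtzNearField_holds stub_harmonicRemainder

/-- Sb from H2 alone (v1.1). -/
theorem vorticalCentre_of_harmonicRemainder (h₂ : HarmonicRemainder) : VorticalCentre :=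
  vorticalCentre_of_stubs helmholtzNearField_holds h₂

/-- Sb from H2♭ alone (v1.2): the whole line modulo ONE shell-kernel estimate. -/
theorem vorticalCentre_of_shellKernelBound (h : ShellKernelBound) : VorticalCentre :=
  vorticalCentre_of_stubs helmholtzNearField_holds (harmonicRemainder_of_shellKernelBound h)

/-! ### §4 CONSUMERS BY NAME (v1.3: the tree kernels `…SilencingCostKernel` / `…SmoothSilenceKernel` are now built) -/

/-- E2 of record (`EmberCensus.TerminalEmber`) ⟸ Sa `RegularAftermath`, H2♭ `ShellKernelBound`, Sc′ `ThickBoxSilencingCost`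
(+ the tree kernel's own Sd): tree `SilencingCost.terminalEmber_of_aftermath_of_vortical_of_thickBox` with Sb discharged. -/
theorem terminalEmber_of_aftermath_of_shellKernel_of_thickBox (hA : RegularAftermath) (h : ShellKernelBound)
    (hS : ThickBoxSilencingCost) : TerminalEmber :=
  SilencingCost.terminalEmber_of_aftermath_of_vortical_of_thickBox hA (vorticalCentre_of_shellKernelBound h) hS

/-- E2 of record through the smooth_silence branch ⟸ Sa♯, H2♭, Sc♮, Sd: tree `SmoothSilence.terminalEmber_of_sharp`
with Sb discharged. -/
theorem terminalEmber_of_sharp_of_shellKernel (hA : SharpAftermath) (h : ShellKernelBound)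
    (hP : SharpEnstrophyPersistence) (hD : SilencingCost.EmberReadout) : TerminalEmber :=
  SmoothSilence.terminalEmber_of_sharp hA (vorticalCentre_of_shellKernelBound h) hP hD

/-! (cold_smoothing v1.1 §5: `ColdSmoothing.terminalEmberM_of_vortical_of_persistence (vorticalCentre_of_shellKernelBound h) hC hD :
EmberCensus.TerminalEmberM` — not imported here to keep the two workfiles independent.) -/

-- certifying examples (targets BY NAME)
example : HelmholtzNearField → HarmonicRemainder →
    Summit.NavierStokesRegularity.NavierStokesRegularity.Cruxes.TypeIQuantSubcubicExp.SilencingCost.VorticalCentre :=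
  vorticalCentre_of_stubs

example (x : EuclideanSpace ℝ (Fin 3)) (v : (EuclideanSpace ℝ (Fin 3)) → (EuclideanSpace ℝ (Fin 3)))
    (y : EuclideanSpace ℝ (Fin 3)) (R : ℝ) (hx : ‖x - y‖ ≤ 2 * (R / 3)) (hR : 0 < R) :
    cutVorticity v y R x = curl v x := by
  rw [cutVorticity_apply, ballCutoff_eq_one (by positivity) hx, one_smul]

end Summit.NavierStokesRegularity.NavierStokesRegularity.Cruxes.TypeIQuantSubcubicExp.HelmholtzCentre

end
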